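import Mathlib.Analysis.SpecialFunctions.Complex.Circle
import HarnessLib

/-!
# The circle has no small subgroups

Topic `Topology/Algebra`; namespace `Literature.Topology.Algebra` (circle lemmas under `Circle`).
A topological group has **no small subgroups** if some neighbourhood of the identity contains no
non-trivial subgroup (D. Montgomery, L. Zippin, *Topological Transformation Groups* (1955), §2;
Lie groups have this property). We prove it for the unit circle `Circle ⊆ ℂ`, in the subgroup
form and in the POWER FORM `∃ V ∈ 𝓝 1, ∀ z, (∀ n : ℕ, z ^ n ∈ V) → z = 1` (with
`V = {re > 0}`: if `z ≠ 1` then `re (z ^ n) = cos (n · arg z) ≤ 0` for some `n`), and record the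
consequence for homomorphisms `χ : G →* A` into a group with such a `V`: a subgroup of `G` inside
`χ ⁻¹' V` lies in `ker χ`; for continuous unitary `χ` there is therefore a neighbourhood of `1`
all of whose subgroups are killed by `χ` (`exists_nhds_one_forall_subgroup_le_ker`).

* `Circle.exists_pow_re_nonpos`, `Circle.eq_one_of_forall_pow_re_pos`,
  `Circle.subgroup_eq_bot_of_forall_re_pos`, `Circle.noSmallSubgroups`, `Circle.noSmallSubgroups'`;
* `map_eq_one_of_forall_pow_mem`, `subgroup_le_ker_of_subset_preimage`, `preimage_mem_nhds_one`,
  `exists_nhds_one_forall_subgroup_le_ker`.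

Used by `Literature/Topology/Algebra/RestrictedProduct/CharacterTrivialAE.lean` (Tate's Lemma
3.2.1: continuous characters of restricted products are trivial on almost all factors) and
`Literature/Topology/Algebra/CircleCharacterExtension.lean` (extension of continuous unitary
characters). The `ℂˣ` analogue (power form) is
`Literature.NumberTheory.Automorphic.unitsComplex_noSmallSubgroups`. Everything is proved
(Mathlib only).

## Provenance

Reproduced for the tree under the LEAN-IN-TREE rule (2026-08-18) from the pub-hodgecm cell's
package file `HodgeCM/PerL34/NoSmallSubgroups.lean` (DAG-node prover #10 lineage, seat pv10, gate
run 18), §§A–B, re-namespaced (`HodgeCM.PerL34.NoSmallSubgroups` ↦ `Literature.Topology.Algebra`),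
with the power form and docstrings / tags added.

## References

* D. Montgomery, L. Zippin, *Topological Transformation Groups* (1955), §2.
* J. Tate, thesis (1950), Cassels–Fröhlich Ch. XV, §3.2, proof of Lemma 3.2.1 ("a neighbourhood
  of `1` in the complex numbers containing no multiplicative subgroup except `{1}`")
  [TateThesis1967].
-/

open _root_.Topology Filter Set

noncomputable section

namespace Literature.Topology.Algebra

/-! ## §1  The circle has no small subgroups -/

/-- If `0 < θ ≤ π` then some natural multiple `n θ` lies in `[π/2, 3π/2]`, so `cos (n θ) ≤ 0`.
[folklore] -/
theorem exists_nat_mul_cos_nonpos {θ : ℝ} (h0 : 0 < θ) (hπ : θ ≤ Real.pi) :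
    ∃ n : ℕ, Real.cos (n * θ) ≤ 0 := by
  refine ⟨⌈(Real.pi / 2) / θ⌉₊, Real.cos_nonpos_of_pi_div_two_le_of_le ?_ ?_⟩
  · have h1 : (Real.pi / 2) / θ ≤ (⌈(Real.pi / 2) / θ⌉₊ : ℝ) := Nat.le_ceil _
    have h2 : (Real.pi / 2) / θ * θ = Real.pi / 2 := by field_simp
    calc Real.pi / 2 = (Real.pi / 2) / θ * θ := h2.symm
      _ ≤ (⌈(Real.pi / 2) / θ⌉₊ : ℝ) * θ := mul_le_mul_of_nonneg_right h1 h0.le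
  · have h1 : (⌈(Real.pi / 2) / θ⌉₊ : ℝ) < (Real.pi / 2) / θ + 1 :=
      Nat.ceil_lt_add_one (by positivity)
    have h2 : (⌈(Real.pi / 2) / θ⌉₊ : ℝ) * θ < ((Real.pi / 2) / θ + 1) * θ :=
      mul_lt_mul_of_pos_right h1 h0
    have h3 : ((Real.pi / 2) / θ + 1) * θ = Real.pi / 2 + θ := by field_simp
    linarith

namespace Circle

/-- For `z ≠ 1` on the unit circle, some power of `z` has non-positive real part
(`re (z ^ n) = cos (n · arg z)`). [folklore] -/
theorem exists_pow_re_nonpos (z : Circle) (hz : z ≠ 1) :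
    ∃ n : ℕ, ((z ^ n : Circle) : ℂ).re ≤ 0 := by
  have hθ0 : 0 < |Complex.arg (z : ℂ)| := by
    rw [abs_pos]
    intro h
    exact hz (Circle.arg_eq_zero.mp h)
  have hθπ : |Complex.arg (z : ℂ)| ≤ Real.pi := Complex.abs_arg_le_pi _
  obtain ⟨n, hn⟩ := exists_nat_mul_cos_nonpos hθ0 hθπ
  refine ⟨n, ?_⟩
  have key : ((z ^ n : Circle) : ℂ).re = Real.cos (n * Complex.arg (z : ℂ)) := by
    rw [Circle.coe_pow]
    conv_lhs => rw [← Complex.norm_mul_exp_arg_mul_I (z : ℂ)]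
    rw [Circle.norm_coe, Complex.ofReal_one, one_mul, ← Complex.exp_nat_mul]
    have : (n : ℂ) * (Complex.arg (z : ℂ) * Complex.I)
        = ((n * Complex.arg (z : ℂ) : ℝ) : ℂ) * Complex.I := by
      push_cast; ring
    rw [this, Complex.exp_ofReal_mul_I_re]
  rw [key]
  have habs : (n : ℝ) * |Complex.arg (z : ℂ)| = |(n : ℝ) * Complex.arg (z : ℂ)| := by
    rw [abs_mul, Nat.abs_cast]
  rwa [habs, Real.cos_abs] at hn

/-- **No small subgroups, power form**: an element of the unit circle all of whose powers have
positive real part is `1`. [folklore] -/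
theorem eq_one_of_forall_pow_re_pos {z : Circle} (hz : ∀ n : ℕ, 0 < ((z ^ n : Circle) : ℂ).re) :
    z = 1 := by
  by_contra hne
  obtain ⟨n, hn⟩ := exists_pow_re_nonpos z hne
  exact absurd (hz n) (not_lt.mpr hn)

/-- **The circle has no small subgroups**: a subgroup of the unit circle all of whose elements
have positive real part (i.e. contained in the open arc of length `π` centred at `1`) is
trivial. [folklore] -/
theorem subgroup_eq_bot_of_forall_re_pos (H : Subgroup Circle)
    (hH : ∀ z ∈ H, 0 < ((z : Circle) : ℂ).re) : H = ⊥ := by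
  rw [Subgroup.eq_bot_iff_forall]
  intro z hz
  exact eq_one_of_forall_pow_re_pos fun n => hH (z ^ n) (H.pow_mem hz n)

/-- The open right half-plane trace `{z | 0 < re z}` is a neighbourhood of `1` in the circle.
[folklore] -/
theorem setOf_re_pos_mem_nhds_one : {z : Circle | 0 < (z : ℂ).re} ∈ 𝓝 (1 : Circle) := by
  apply IsOpen.mem_nhds
  · exact isOpen_lt continuous_const (Complex.continuous_re.comp continuous_subtype_val)
  · show 0 < ((1 : Circle) : ℂ).re
    simp

/-- **The circle has no small subgroups** (power form, as a neighbourhood statement): there is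
a neighbourhood `V` of `1` such that `z = 1` as soon as all powers of `z` lie in `V`
(Montgomery–Zippin §2). [folklore] -/
theorem noSmallSubgroups :
    ∃ V ∈ 𝓝 (1 : Circle), ∀ z : Circle, (∀ n : ℕ, z ^ n ∈ V) → z = 1 :=
  ⟨{z : Circle | 0 < (z : ℂ).re}, setOf_re_pos_mem_nhds_one,
    fun _ hz => eq_one_of_forall_pow_re_pos hz⟩

/-- **The circle has no small subgroups** (subgroup form): there is a neighbourhood of `1`
containing no subgroup other than `⊥`. [folklore] -/
theorem noSmallSubgroups' :
    ∃ V ∈ 𝓝 (1 : Circle), ∀ H : Subgroup Circle, (H : Set Circle) ⊆ V → H = ⊥ :=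
  ⟨{z : Circle | 0 < (z : ℂ).re}, setOf_re_pos_mem_nhds_one,
    fun H hH => subgroup_eq_bot_of_forall_re_pos H fun _ hz => hH hz⟩

end Circle

/-! ## §2  No small subgroups: subgroups near `1` lie in the kernel -/

section Target

variable {G : Type*} [Group G] {A : Type*} [Group A]

/-- If `V ⊆ A` detects the identity through powers (`∀ a, (∀ n, a ^ n ∈ V) → a = 1`, the
power form of "no small subgroups"), then every `g` all of whose powers lie in `χ ⁻¹' V` is in
the kernel of `χ : G →* A`. [folklore] -/
theorem map_eq_one_of_forall_pow_mem {χ : G →* A} {V : Set A}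
    (hV : ∀ a : A, (∀ n : ℕ, a ^ n ∈ V) → a = 1) {g : G} (hg : ∀ n : ℕ, g ^ n ∈ χ ⁻¹' V) :
    χ g = 1 :=
  hV (χ g) fun n => by
    have h := hg n
    rwa [Set.mem_preimage, map_pow] at h

/-- A subgroup contained in `χ ⁻¹' V`, `V ⊆ A` detecting the identity through powers, lies in
the kernel of `χ` (Tate: "`c(G^S) ⊆ U ⇒ c(G^S) = 1`"). [folklore] -/
theorem subgroup_le_ker_of_subset_preimage {χ : G →* A} {V : Set A}
    (hV : ∀ a : A, (∀ n : ℕ, a ^ n ∈ V) → a = 1) (K : Subgroup G) (hK : (K : Set G) ⊆ χ ⁻¹' V) :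
    K ≤ χ.ker :=
  fun _ hk => (MonoidHom.mem_ker).mpr (map_eq_one_of_forall_pow_mem hV fun n => hK (K.pow_mem hk n))

variable [TopologicalSpace G] [TopologicalSpace A]

/-- The preimage of a neighbourhood of `1` under a continuous homomorphism is a neighbourhood of
`1`. [folklore] -/
theorem preimage_mem_nhds_one {χ : G →* A} (hχ : Continuous χ) {V : Set A} (hV : V ∈ 𝓝 (1 : A)) :
    (χ : G → A) ⁻¹' V ∈ 𝓝 (1 : G) :=
  hχ.continuousAt.preimage_mem_nhds (by simpa only [map_one] using hV)

/-- **No small subgroups, for continuous unitary characters**: a continuous `χ : G →* Circle`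
kills every subgroup contained in the neighbourhood `χ ⁻¹' {re > 0}` of `1`; in particular there
is a neighbourhood of `1` in `G` all of whose subgroups lie in `ker χ`. [folklore] -/
theorem exists_nhds_one_forall_subgroup_le_ker (χ : G →* Circle) (hχ : Continuous χ) :
    ∃ U ∈ 𝓝 (1 : G), ∀ K : Subgroup G, (K : Set G) ⊆ U → K ≤ χ.ker := by
  obtain ⟨V, hV, hVA⟩ := Circle.noSmallSubgroups
  exact ⟨_, preimage_mem_nhds_one hχ hV, fun K hK => subgroup_le_ker_of_subset_preimage hVA K hK⟩

end Target

end Literature.Topology.Algebra
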